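/-
Copyright: seat `ym-line-cbag-p2` (prover-ym-line-cbag-p2-g0-0), route `ColdBoxAllGroups`, crux `BulkAllGroups`
(stmt-QuantumFields-22255), line `dlr-chessboard-G` (skeleton `Cruxes/BulkAllGroups/Lines/birth.lean`).
-/
import Summits.QuantumFields.YangMills.Theses.ColdBoxAllGroups
import Summits.QuantumFields.YangMills.Theorems.ColdBoxAllGroupsDefs
import Summits.QuantumFields.YangMills.Theorems.WeakCouplingRatesCurvatureCorrPowerFloor

/-!
# Stub L4-G `stub_boxPolyFloorG` of crux `BulkAllGroups` (stmt-QuantumFields-22255) REDUCED to the route's sibling crux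
# BOX_G (`BoxFloorAllGroups`, stmt-QuantumFields-22254) and the PROVED G-free FLOOR (`curvatureCorrPowerFloor_proof`)

The line `dlr-chessboard-G` registers `stub_boxPolyFloorG : ∀ G r, ∃ θk > 0, ∀ 0 < θ ≤ θk, BoxPolyFloorG r.ρ (θ/20) θ (2 + θ/2)` — the
cold-wall box covariance at separation `⌈β^{θ/20}⌉` in the box of side `2⌈β^θ⌉+1` is eventually `≥ β^{−(2+θ/2)}`.  As in the `SU(2)` line
(`boxPolyFloor_of_box_floor`, `WeakCouplingRatesBulkDominatesColdBoxWBoxPolyFloorOfBox`) it is NOT independent content: it is the sibling crux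
BOX_G + the FLOOR + rpow arithmetic.  This file proves exactly that, G-generically:

* `boxPolyFloorG_of_boxTwoPointDomination` — for ANY `ρ`: a ceiling `θ₀` under which `∃ c > 0, BoxTwoPointDomination ρ A θ c` holds for all
  `0 < A < θ ≤ θ₀`, together with the tree's FLOOR `κ/n⁴ ≤ |C(n)|`, gives `BoxPolyFloorG ρ (θ/20) θ (2 + θ/2)` for `0 < θ ≤ θ₀`:
  `β²·boxPlaqCov ≥ c·C(T)² ≥ c·κ²/T⁸ ≥ (cκ²/256)·β^{−8A}`, `A = θ/20`, `T = ⌈β^A⌉ ≤ 2β^A`, and `(cκ²/256)·β^{−2−0.4θ} ≥ β^{−2−θ/2}` eventually;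
* `stub_boxPolyFloorG_of_boxFloorAllGroups : BoxFloorAllGroups → (the registered statement of stub_boxPolyFloorG)`.
The day item 22254 closes (`BoxFloorAllGroups_holds`), the registered stub is the one-line corollary.  NOT a claim about the mass gap; nothing
here is analytic; the Yang–Mills mass gap is NOT proved by any of this.
-/

set_option autoImplicit false

noncomputable section

open Filter Topology
open Literature.MathematicalPhysics.QuantumFieldTheory
open Literature.MathematicalPhysics.QuantumLattice
open Summit.QuantumFields.YangMills.Theorems.WeakCouplingRates
open Summit.QuantumFields.YangMills.Theses.ColdBoxAllGroups (BoxFloorAllGroups)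

namespace Summit.QuantumFields.YangMills.Theorems.ColdBoxAllGroups

section Generic

variable {N : ℕ} {G : Type*} [Group G] [TopologicalSpace G] [IsTopologicalGroup G] [CompactSpace G]
  [MeasurableSpace G] [BorelSpace G]
variable (ρ : G →* Matrix (Fin N) (Fin N) ℂ)

/-- **The polynomial box floor from Gaussian domination under a ceiling + FLOOR**, any `ρ`: if for all `0 < A < θ ≤ θ₀` some `c > 0` has
`BoxTwoPointDomination ρ A θ c`, then for every `0 < θ ≤ θ₀` the cold-wall box covariance satisfies
`β^{−(2+θ/2)} ≤ boxPlaqCov ρ β ⌈β^θ⌉ ⌈β^{θ/20}⌉` for all large `β` (the tree's FLOOR `curvatureCorrPowerFloor_proof` and rpow arithmetic: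
`c κ² / 256 · β^{−2−0.4θ} ≥ β^{−2−θ/2}` eventually). [folklore] -/
theorem boxPolyFloorG_of_boxTwoPointDomination {θ₀ : ℝ}
    (hbox : ∀ A θ : ℝ, 0 < A → A < θ → θ ≤ θ₀ → ∃ c : ℝ, 0 < c ∧ BoxTwoPointDomination ρ A θ c)
    {θ : ℝ} (hθ : 0 < θ) (hθ1 : θ ≤ θ₀) : BoxPolyFloorG ρ (θ / 20) θ (2 + θ / 2) := by
  obtain ⟨κ, hκ, n₀, hfloor⟩ := curvatureCorrPowerFloor_proof
  have hA : 0 < θ / 20 := by positivity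
  have hAθ : θ / 20 < θ := by linarith
  obtain ⟨c, hc, β₁, hdom⟩ := hbox (θ / 20) θ hA hAθ hθ1
  -- `⌈β^A⌉ ≥ n₀` and `c κ²/256 ≥ β^{-θ/10}` eventually
  have hT : Tendsto (fun β : ℝ => β ^ (θ / 20)) atTop atTop := tendsto_rpow_atTop hA
  have hev1 : ∀ᶠ β : ℝ in atTop, (n₀ : ℝ) ≤ β ^ (θ / 20) := hT.eventually_ge_atTop _
  have hsmall : Tendsto (fun β : ℝ => β ^ (-(θ / 10))) atTop (𝓝 0) := tendsto_rpow_neg_atTop (by positivity)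
  have hev2 : ∀ᶠ β : ℝ in atTop, β ^ (-(θ / 10)) < c * κ ^ 2 / 256 := hsmall.eventually (gt_mem_nhds (by positivity))
  obtain ⟨β₂, hβ₂⟩ := Filter.eventually_atTop.1 (hev1.and hev2)
  refine ⟨max (max β₁ β₂) 1, fun β hβ => ?_⟩
  simp only [max_le_iff] at hβ
  obtain ⟨⟨hb1, hb2⟩, hb3⟩ := hβ
  have hβ0 : 0 < β := by linarith
  obtain ⟨hn₀, hcκ⟩ := hβ₂ β hb2
  have hd := hdom β hb1
  -- the floor at `T = ⌈β^A⌉`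
  obtain ⟨hT1, hT2⟩ := one_le_ceil_rpow_and_le hb3 hA.le
  have hTn : n₀ ≤ ⌈β ^ (θ / 20)⌉₊ := by
    have : (n₀ : ℝ) ≤ (⌈β ^ (θ / 20)⌉₊ : ℝ) := hn₀.trans (Nat.le_ceil _)
    exact_mod_cast this
  have hC := hfloor _ hTn
  have hTpos : (0 : ℝ) < (⌈β ^ (θ / 20)⌉₊ : ℝ) := by linarith
  -- `C(T)² ≥ κ² / T⁸ ≥ κ² / (256 β^{8A})`
  have hC2 : κ ^ 2 / ((⌈β ^ (θ / 20)⌉₊ : ℝ) ^ 4) ^ 2 ≤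
      curvaturePlaquetteCorr (d := 4) (by norm_num) (⌈β ^ (θ / 20)⌉₊ : ℤ) ^ 2 := by
    have h1 : κ / (⌈β ^ (θ / 20)⌉₊ : ℝ) ^ 4 ≤ |curvaturePlaquetteCorr (d := 4) (by norm_num) (⌈β ^ (θ / 20)⌉₊ : ℤ)| := by
      simpa using hC
    have h0 : 0 ≤ κ / (⌈β ^ (θ / 20)⌉₊ : ℝ) ^ 4 := by positivity
    have h2 := pow_le_pow_left₀ h0 h1 2
    rw [sq_abs, div_pow] at h2
    exact h2
  have hT8 : ((⌈β ^ (θ / 20)⌉₊ : ℝ) ^ 4) ^ 2 ≤ 256 * β ^ (8 * (θ / 20)) := by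
    have h := pow_le_pow_left₀ hTpos.le hT2 8
    rw [← pow_mul]
    norm_num
    calc (⌈β ^ (θ / 20)⌉₊ : ℝ) ^ 8 ≤ (2 * β ^ (θ / 20)) ^ 8 := h
      _ = 256 * (β ^ (θ / 20)) ^ 8 := by rw [mul_pow]; norm_num
      _ = 256 * β ^ (8 * (θ / 20)) := by
          rw [← Real.rpow_natCast (β ^ (θ / 20)) 8, ← Real.rpow_mul hβ0.le]; norm_num; ring_nf
  have hsig : c * κ ^ 2 / (256 * β ^ (8 * (θ / 20))) ≤ β ^ 2 * boxPlaqCov ρ β ⌈β ^ θ⌉₊ ⌈β ^ (θ / 20)⌉₊ := by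
    have hpos8 : (0 : ℝ) < ((⌈β ^ (θ / 20)⌉₊ : ℝ) ^ 4) ^ 2 := by positivity
    calc c * κ ^ 2 / (256 * β ^ (8 * (θ / 20))) ≤ c * (κ ^ 2 / ((⌈β ^ (θ / 20)⌉₊ : ℝ) ^ 4) ^ 2) := by
          rw [mul_div_assoc]
          exact mul_le_mul_of_nonneg_left (div_le_div_of_nonneg_left (sq_nonneg κ) hpos8 hT8) hc.le
      _ ≤ c * curvaturePlaquetteCorr (d := 4) (by norm_num) (⌈β ^ (θ / 20)⌉₊ : ℤ) ^ 2 :=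
          mul_le_mul_of_nonneg_left hC2 hc.le
      _ ≤ _ := hd
  -- rpow bookkeeping: `β^{-(2+θ/2)} ≤ (cκ²/256) β^{-2-0.4θ}`
  have hβ2 : (0 : ℝ) < β ^ (2 : ℝ) := Real.rpow_pos_of_pos hβ0 2
  have e8 : β ^ (8 * (θ / 20)) = β ^ (θ / 2) * β ^ (-(θ / 10)) := by
    rw [← Real.rpow_add hβ0]; ring_nf
  have key : β ^ (-(2 + θ / 2)) ≤ c * κ ^ 2 / (256 * β ^ (8 * (θ / 20))) / β ^ 2 := by
    rw [e8, le_div_iff₀ (by positivity), le_div_iff₀ (by positivity)]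
    have hsplit : β ^ (-(2 + θ / 2)) * β ^ (2 : ℕ) * (256 * (β ^ (θ / 2) * β ^ (-(θ / 10)))) = 256 * β ^ (-(θ / 10)) := by
      rw [← Real.rpow_natCast β 2]
      have : β ^ (-(2 + θ / 2)) * β ^ ((2 : ℕ) : ℝ) * β ^ (θ / 2) = 1 := by
        rw [← Real.rpow_add hβ0, ← Real.rpow_add hβ0]; norm_num
      calc β ^ (-(2 + θ / 2)) * β ^ ((2 : ℕ) : ℝ) * (256 * (β ^ (θ / 2) * β ^ (-(θ / 10))))
          = 256 * (β ^ (-(2 + θ / 2)) * β ^ ((2 : ℕ) : ℝ) * β ^ (θ / 2)) * β ^ (-(θ / 10)) := by ring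
        _ = 256 * β ^ (-(θ / 10)) := by rw [this, mul_one]
    rw [hsplit]
    linarith
  have hfin : c * κ ^ 2 / (256 * β ^ (8 * (θ / 20))) / β ^ 2 ≤ boxPlaqCov ρ β ⌈β ^ θ⌉₊ ⌈β ^ (θ / 20)⌉₊ := by
    rw [div_le_iff₀ (by positivity)]
    linarith
  exact key.trans hfin

end Generic

/-- **`stub_boxPolyFloorG` from BOX_G**: if the sibling crux `BoxFloorAllGroups` (stmt-QuantumFields-22254) holds, then for every compact simple
`G` and every `r : LatticeRep G` there is `θk > 0` (BOX_G's ceiling `θ₀(G, r)`) such that for all `0 < θ ≤ θk` the cold-wall box covariance is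
eventually `≥ β^{−(2+θ/2)}` at `(A, θ) = (θ/20, θ)` — literally the registered statement of stub L4-G of the `dlr-chessboard-G` line (crux's
instance `borel G`).  The day item 22254 closes, the stub is `stub_boxPolyFloorG_of_boxFloorAllGroups BoxFloorAllGroups_holds`. [folklore] -/
theorem stub_boxPolyFloorG_of_boxFloorAllGroups (hBox : BoxFloorAllGroups) :
    ∀ (G : Type) [Group G] [TopologicalSpace G] [IsTopologicalGroup G] [CompactSpace G],
    IsCompactSimpleLieGroup G →
    letI : MeasurableSpace G := borel G
    haveI : BorelSpace G := ⟨rfl⟩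
    ∀ r : LatticeRep G, ∃ θk : ℝ, 0 < θk ∧ ∀ θ : ℝ, 0 < θ → θ ≤ θk →
      BoxPolyFloorG r.ρ (θ / 20) θ (2 + θ / 2) := by
  intro G _ _ _ _ hG
  letI : MeasurableSpace G := borel G
  haveI : BorelSpace G := ⟨rfl⟩
  intro r
  obtain ⟨θ₀, hθ₀, hbox⟩ := hBox G hG r
  exact ⟨θ₀, hθ₀, fun θ hθ hθ1 => boxPolyFloorG_of_boxTwoPointDomination r.ρ hbox hθ hθ1⟩


/-! ## Appended (skeleton v2, 2026-08-27): the instance-binder form of stub L4-G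

The registered stubs of the `dlr-chessboard-G` line were restated with instance binders `[MeasurableSpace G] [BorelSpace G]` in place of
`letI : MeasurableSpace G := borel G` (the gate's signature extraction truncates at the first top-level `:=`).  Since `BorelSpace G` forces
`‹MeasurableSpace G› = borel G`, the instance-binder form follows from the `borel G` form by `subst`. -/

/-- **`stub_boxPolyFloorG` (registered, instance-binder form) from BOX_G**: if the sibling crux `BoxFloorAllGroups` holds, then for every
compact simple `G` with ANY Borel measurable structure and every `r : LatticeRep G` there is `θk > 0` such that for all `0 < θ ≤ θk`,
`BoxPolyFloorG r.ρ (θ/20) θ (2 + θ/2)` — literally the registered statement of stub L4-G (skeleton v2).  The day item 22254 closes, the stub is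
`stub_boxPolyFloorG_of_boxFloorAllGroups' BoxFloorAllGroups_holds`. [folklore] -/
theorem stub_boxPolyFloorG_of_boxFloorAllGroups' (hBox : BoxFloorAllGroups) :
    ∀ (G : Type) [Group G] [TopologicalSpace G] [IsTopologicalGroup G] [CompactSpace G] [MeasurableSpace G] [BorelSpace G],
    IsCompactSimpleLieGroup G → ∀ r : LatticeRep G, ∃ θk : ℝ, 0 < θk ∧ ∀ θ : ℝ, 0 < θ → θ ≤ θk →
      BoxPolyFloorG r.ρ (θ / 20) θ (2 + θ / 2) := by
  intro G _ _ _ _ mG hBG hG r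
  have hm : mG = borel G := @BorelSpace.measurable_eq G _ mG hBG
  subst hm
  letI : MeasurableSpace G := borel G
  obtain ⟨θ₀, hθ₀, hbox⟩ := hBox G hG r
  exact ⟨θ₀, hθ₀, fun θ hθ hθ1 => boxPolyFloorG_of_boxTwoPointDomination r.ρ hbox hθ hθ1⟩

end Summit.QuantumFields.YangMills.Theorems.ColdBoxAllGroups

end
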